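import Summits.BirchSwinnertonDyer.Rank1Residual.X1.KellerYinTheoremAClass
import Summits.BirchSwinnertonDyer.Rank1Residual.X1.KellerYinIMC2HalvesPub
import HarnessLib

/-!
# THEOREM A on class X1 (type A, analytic rank 1) with its ONE preprint input reduced to
# Keller–Yin's `μ/λ` statement: `BSD(E,p)` ⇐ fifteen PUBLISHED named facts + `GoodLatticeMuLambdaOnTree`
# (cell `bsd-eis`, `run/shared/lean/pub/bsd-eis/`; seat `bsd-eis-ky` gen 6; THEOREMS ONLY)

HONEST FRAMING (FULL-BSD rank-≤1 programme D-0033, row A1 = class X1 ∩ {`r_an = 1`, type A}: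
good ANOMALOUS Eisenstein prime `p > 2`, 7 892 census cells; route `EisensteinPrimes` crux rank 2
`GoodLatticeBDPValue` = stmt-BirchSwinnertonDyer-19032). THEOREM A
(`X1/KellerYinTheoremAClass.lean`, p403478: `forall_bsdp_classX1_typeA_rankOne`) takes ONE preprint
input `h308` (Keller–Yin arXiv:2402.12781v2 Thm. 3.0.8 at the good lattice read at `𝟙`) and eleven
published facts. `X1/KellerYinIMC2HalvesPub.lean` proves `h308` from FOUR further published named
facts (Castella–Hsieh 2018 Def. 3.7/Prop. 3.8, Carayol, CGLS 2022 proof of Thm. 4.2.2 first half,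
CGLS 2022 Thm. 5.1.3) and the ONE statement `GoodLatticeMuLambdaOnTree` (`μ = 0` and `λ`-equality
for the good lattice at an anomalous prime = Keller–Yin Thm. 1.5.1 + Thms. 2.2.1–2.2.3, the part of
the preprint that is NOT in refereed print; the cell's own derivation is HOME/bsd-eis-ky-MEMO-1.md
§3A′/R2, referee PASS). This file is the composition: row A1's class statement with the preprint
content confined, in the kernel, to that single `μ/λ` statement. Nothing asserted; no label moves;
CONDITIONAL on the named inputs (fifteen `def … : Prop` Literature facts, all PUBLISHED, displayed
as hypotheses; and `hml`, PREPRINT content, displayed as a hypothesis).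

References: [KellerYin2024] Thm. 4.2.1 (Theorem C), Thm. 3.0.8, Thm. 1.5.1, Thms. 2.2.1–2.2.3;
[CastellaGrossiLeeSkinner2022] Thms. 4.1.2, 5.1.1, 5.1.3, Rem. 4.1.3, Prop. 4.2.1, Thm. 5.3.1;
[CastellaHsieh2018] Def. 3.7, Prop. 3.8; [Carayol1986]; [GreenbergVatsal2000] Thm. (1.3);
[Ribet1976] Prop. 2.1; HOME/bsd-eis-ky-MEMO-7.md.
-/

set_option autoImplicit false

noncomputable section

open scoped Classical

open WeierstrassCurve Literature.NumberTheory.EllipticCurves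
  Literature.NumberTheory.EllipticCurves.ModularForms
  Literature.NumberTheory.EllipticCurves.Rank1Residual
  Literature.NumberTheory.EllipticCurves.CastellaGrossiLeeSkinner2022
  Literature.NumberTheory.EllipticCurves.KellerYin2024
  Summit.BirchSwinnertonDyer.Rank1Residual.X1.KellerYinHalves

namespace Summit.BirchSwinnertonDyer.Rank1Residual.X1.KellerYinTheoremA

/-- **THEOREM A on the class, preprint content = ONE `μ/λ` statement.** For ALL globally minimal
`W/ℚ` and primes `p`: `ClassX1 W p → ¬ GVPar W p → W.analyticRank = 1 → BSDp W p`, granted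
(a) `hml : ∀ W p, GoodLatticeMuLambdaOnTree W p` — Keller–Yin Thm. 1.5.1 + Thms. 2.2.1–2.2.3 (`μ = 0`
and `λ(𝔛) = λ(𝓛)` for the good lattice at an anomalous prime; PREPRINT content), and (b) FIFTEEN
PUBLISHED named facts: `hCH` (Castella–Hsieh 2018 Def. 3.7/Prop. 3.8: the BDP frame exists at a good
prime), `hC` (Carayol: level = conductor), `hdiv` (CGLS 2022 proof of Thm. 4.2.2 first half = Thm.
4.1.2 + Rem. 4.1.3 + Prop. 4.2.1 under (h1): one-sided IMC2 divisibility), `hval` (CGLS Thm. 5.1.3: BDP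
value at `𝟙`), `h511` (CGLS Thm. 5.1.1 as proved), `hCassels`, `hGV` (Greenberg–Vatsal (1.3) on the
type-B partner), `hGr` (Greenberg LNM 1716 Thm. 4.1), `hmodP`, `hmod` (modularity), `hHL`
(Hoffstein–Luo), `hGZQ` (Gross–Zagier I.7.3), `hGZ`, `hKo` (Gross–Zagier, Kolyvagin over `K`), `hGZK`.
Proof: `forall_bsdp_classX1_typeA_rankOne` (p403478) with `h308 := thm308_of_cgls_of_muLambda hCH hC
hdiv hval hml`. CONDITIONAL; nothing booked. [claim: KellerYin2024, status: under-review]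
[cite: KellerYin2024, Thm. 4.2.1 (Theorem C), Thm. 3.0.8, Thm. 1.5.1, Thms. 2.2.1–2.2.3]
[cite: CastellaGrossiLeeSkinner2022, Thm. 4.1.2, Rem. 4.1.3, Prop. 4.2.1, Thms. 5.1.1, 5.1.3, 5.3.1]
[cite: CastellaHsieh2018, Def. 3.7 and Prop. 3.8] [cite: Carayol1986] [cite: GreenbergVatsal2000, Thm. (1.3)]
[cite: Miller2011LMS, Def. 1.1] -/
theorem forall_bsdp_classX1_typeA_rankOne_of_muLambda
    (hml : ∀ (W : WeierstrassCurve ℚ) [W.IsElliptic] [W.IsGloballyMinimal] (p : ℕ) [Fact p.Prime],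
      GoodLatticeMuLambdaOnTree W p)
    (hCH : castellaHsieh2018_exists_isBDPLFunction)
    (hC : ∀ (N : ℕ) [NeZero N], IsNewformOf.level_eq_conductorNorm (N := N))
    (hdiv : proofThm422_exists_isBDPLFunction_isTorsion_charIdeal_dvd)
    (hval : thm513_exists_isBDPLFunction_valueAtOne)
    (h511 : thm511_anticyclotomicControl_of_torsionFree) (hCassels : bsdRHS_eq_of_isIsogenous)
    (hGV : GreenbergVatsal2000.thm13_charIdeal_eq_of_gvPar) (hGr : greenberg_charValue_rankZero)
    (hmodP : nonempty_modularParametrizationData) (hmod : exists_isNewformOf)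
    (hHL : HoffsteinLuo1997_exists_twist_L_one_ne_zero) (hGZQ : GrossZagier1986_thm_I_7_3)
    (hGZ : ∀ (N : ℕ) [NeZero N] (W : WeierstrassCurve ℚ) (K : Type) [Field K] [NumberField K],
      gross_zagier N W K)
    (hKo : ∀ (N : ℕ) [NeZero N] (W : WeierstrassCurve ℚ) (K : Type) [Field K] [NumberField K],
      kolyvagin N W K)
    (hGZK : rank_eq_analyticRank_of_analyticRank_le_one) :
    ∀ (W : WeierstrassCurve ℚ) [W.IsElliptic] [W.IsGloballyMinimal] (p : ℕ) [Fact p.Prime],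
      ClassX1 W p → ¬ GVPar W p → W.analyticRank = 1 → BSDp W p :=
  forall_bsdp_classX1_typeA_rankOne (thm308_of_cgls_of_muLambda hCH hC hdiv hval hml) h511 hCassels hGV
    hGr hmodP hmod hHL hGZQ hGZ hKo hGZK

end Summit.BirchSwinnertonDyer.Rank1Residual.X1.KellerYinTheoremA

end
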